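import Summits.QuantumAdvantage.QuantumAdvantage.Theses.CentralFactorial

/-!
# Route `CentralFactorial`: the `Assembly` item (stmt-QuantumAdvantage-10312)

The assembly item of route `CentralFactorial` is pure logic: it is the route's deciding theorem `closes` (`MatthewsQuarticSign → WilsonMemBQPOfMatthews → WilsonThesis → QuantumAdvantage`, witness `⟨L_W, h₂ h₁, h₃⟩`) uncurried verbatim.
HONEST FRAMING (block-2b rule): a closed ledger item (settled-trivial), NOT summit progress — the route's
cruxes are untouched.
-/

set_option linter.dupNamespace false -- D-0017: single-problem summit ⇒ `QuantumAdvantage.QuantumAdvantage` by design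

namespace Summit.QuantumAdvantage.QuantumAdvantage.Theorems.CentralFactorial

/-- **`CentralFactorial.Assembly`** (stmt-QuantumAdvantage-10312): pure logic. [folklore] -/
theorem Assembly_proof : Summit.QuantumAdvantage.QuantumAdvantage.Theses.CentralFactorial.Assembly := by
  unfold Summit.QuantumAdvantage.QuantumAdvantage.Theses.CentralFactorial.Assembly
  exact fun h₁ h₂ h₃ => ⟨_, h₂ h₁, h₃⟩

end Summit.QuantumAdvantage.QuantumAdvantage.Theorems.CentralFactorial
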